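import Summits.BirchSwinnertonDyer.Rank1Residual.Additive.CycLeadingTermDvdConverse
import Summits.BirchSwinnertonDyer.Rank1Residual.Additive.GordCharLeadingTerm
import HarnessLib

/-!
# `CycLeadingTermDvdAt ↔ CycLowerLeadingTermAt` (unconditionally), and the (M)-locus lower-half END
# STATE restated over the decl of record `CycLowerLeadingTermAt` (cell `b2b-bsdres`, team n1011,
# seat n1011-p18, sub-target T-N10b, file 4; lead ruling 2026-08-21T05:04Z / R3-2)

HONEST FRAMING (cell `b2b-bsdres`, run/shared/lean/b2b/bsd-rank1-residual/, verbatim in every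
file): the goal of the cell is to DELETE the COMBINATION-SHAPED residual classes of the
Birch–Swinnerton-Dyer formula for ALL analytic-rank `≤ 1` elliptic curves over `ℚ` — "full BSD
formula for every rank `≤ 1` curve in class `C`" assembled STRICTLY from published theorems — so
that the rank-`≤ 1` remainder becomes exactly the CONSTRUCTION-SHAPED classes, which are TYPED
(missing-input `Prop`s), NOT attempted. This is not "finishing BSD". Team n1011 (RESIDUAL-MAP §I
N10/N11), sub-target T-N10b: research route; no claim beyond the stated classes; N10 stays
CONSTRUCTION / NEEDS; labels unchanged; nothing booked. THEOREMS ONLY (no definition, no named fact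
minted); every published input is an explicit named-fact hypothesis of the tree; no `_holds`.

## What this file proves

Two seats typed the MAIN-CONJECTURE ("`⊆`") direction of Delbourgo's Main Conjecture (G)/(M)
(Compositio 113 (1998) p. 151) at `T = 0` within minutes of each other: seat additive-p2's
`CycLowerLeadingTermAt W p` (`Additive/GordCharLeadingTerm.lean`: for every GENERATOR `f` of
`char_Λ X(E/ℚ_∞)`, `L(E,1)/Ω_E ∣ f(0)` in `ℤ_p`) — the team's DECL OF RECORD (n1011 lead ruling
2026-08-21T05:04Z) — and this seat's `CycLeadingTermDvdAt W p` (`Additive/CycLeadingTermDvd.lean`: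
the same for EVERY ELEMENT `g` of the characteristic ideal). They are EQUIVALENT with no hypothesis:
a generator is an element; every element is a multiple of a generator and `char_Λ X` is principal
(`Λ` a UFD; tree theorem `charIdeal_isPrincipal_holds`).

* §1 **`cycLeadingTermDvdAt_iff_cycLowerLeadingTermAt`** — for every `W`, `p`:
  `CycLeadingTermDvdAt W p ↔ CycLowerLeadingTermAt W p`. So there is ONE rank-`0` lower input in two
  spellings; every theorem of `CycLeadingTermDvd{,Converse,PotMult}.lean` transfers verbatim.
* §2 the (M)-locus END STATE over the decl of record (seat additive-p2's consumers of
  `CycLowerLeadingTermAt` live on the (G)-cell at `p ≥ 5` via Delbourgo 2002; these are the (M) rows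
  at EVERY odd `p`, `3` included, via Delbourgo 1998 Prop. 4 + §2.2 Lemma (ii) = fact
  `prop4_rankZero_constantCoeff_eq_unit_mul_of_potMult`, `hDelX`):
  `PotMult.missingLowerBoundAt_iff_cycLowerLeadingTermAt_rankZero` (**`MissingLowerBoundAt W p ↔
  CycLowerLeadingTermAt W p`** on (M) ∧ `r_an = 0`, Tamagawa binder discharged by
  `PotMult.not_dvd_tamagawaNumberAt`), `ClassX4M./ClassX3M.missingLowerBoundAt_rankZero_of_cycLowerLeadingTerm`,
  **`ClassX4M.bsdp_rankZero_of_surj_of_cycLowerLeadingTerm`** / **`ClassX3M.bsdp_rankZero_of_cycLowerLeadingTerm`**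
  (`BSD(E,p)` on X4(M) ∧ surj ∧ r0 / X3♯(M) ∧ r0 at EVERY odd `p` ⟸ the decl of record + the
  published-fact upper halves of seat additive-p1), `ClassX4M./ClassX3M.bsdp_rankZero_of_cycChar`
  (`BSD(E,p)` ⟸ the MC EQUALITY at `T = 0`, `CycCharLeadingTermAt W p`, + Prop. 4 both ways — no
  image / Tamagawa / Manin / Kato-reading binder), and the `…MissingInputAt ↔ CycLowerLeadingTermAt`
  forms. At `p = 3` the X4(M) ∧ surj rows are the (M)@3 part of RESIDUAL-MAP §I N11.

* §3 (appended) the (G)-ordinary / class-agnostic SOCKETS over the decl of record: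
  `ClassX4Gord./ClassX3Gord.missingLowerBoundAt_rankZero_of_cycLowerLeadingTerm_of_exact` and
  `missingLowerBoundAt_of_cycLowerLeadingTerm_of_exact` — lower half ⟸ `CycLowerLeadingTermAt W p` ∧
  `ExactLeadingTermAt W p` (the exactness of Prop. 4's `H¹`-factor, to be supplied per sub-locus,
  e.g. from Delbourgo 2002 Thm (B) at `p = 3` on the `I₀*`-ordinary rows by team row T-b2c).

The typed input is OPEN (printed nowhere at an additive prime); X4(M), X3♯(M) stay
CONSTRUCTION-SHAPED; nothing booked.

References: D. Delbourgo, Compositio Math. 113 (1998) 123–154, §2.2 Lemma (ii) (p. 139), Prop. 4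
(p. 144), Main Conjecture (p. 151) [Delbourgo1998]; R. L. Miller, LMS J. Comput. Math. 14 (2011)
Def. 1.1 [Miller2011LMS]; C. Wuthrich, Doc. Math. 19 (2014) Thm. 16, Lemma 20, Cor. 19 [Wuthrich2014];
L. C. Washington, *Introduction to Cyclotomic Fields*, §13.2 (char ideal principal) [Washington1997].
-/

noncomputable section

open scoped Classical NumberField

open WeierstrassCurve NumberField Literature.NumberTheory.EllipticCurves
  Literature.NumberTheory.EllipticCurves.ModularForms
  Literature.NumberTheory.EllipticCurves.Rank1Residual
  Literature.NumberTheory.EllipticCurves.Rank1Residual.Typed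
  IsDedekindDomain Rat.HeightOneSpectrum

namespace Summit.BirchSwinnertonDyer.Rank1Residual.Additive

/-! ### §1 The two spellings of the `T = 0` lower divisibility are equivalent -/

/-- **`CycLeadingTermDvdAt W p ↔ CycLowerLeadingTermAt W p`, unconditionally.** "`L(E,1)/Ω_E`
divides `g(0)` for EVERY `g ∈ char_Λ X(E/ℚ_∞)`" ⟺ "… for every GENERATOR `f`": a generator is an
element (`Ideal.mem_span_singleton_self`); conversely `char_Λ X` is principal
(`charIdeal_isPrincipal_holds`), every element is `g = h · f`, and `g(0) = h(0) · f(0)`. Bookkeeping.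
[cite: Delbourgo1998, Main Conjecture (p. 151) (shape only)] [cite: Washington1997, §13.2] -/
theorem cycLeadingTermDvdAt_iff_cycLowerLeadingTermAt (W : WeierstrassCurve ℚ) (p : ℕ) [Fact p.Prime] :
    CycLeadingTermDvdAt W p ↔ CycLowerLeadingTermAt W p := by
  constructor
  · intro h κ γ hκ hγ hγ' D f hf
    have hfmem : f ∈ D.charIdeal := by
      rw [hf]
      exact Ideal.mem_span_singleton_self f
    obtain ⟨z, q, hLq, hf0⟩ := h κ γ hκ hγ hγ' D f hfmem
    exact ⟨q, hLq, z, hf0⟩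
  · intro h κ γ hκ hγ hγ' D g hg
    haveI : (Module.charIdeal (IwasawaAlgebra p) D.X).IsPrincipal := charIdeal_isPrincipal_holds p D.X
    obtain ⟨f, hf⟩ := Submodule.IsPrincipal.principal (Module.charIdeal (IwasawaAlgebra p) D.X)
    obtain ⟨q, hLq, c, hf0⟩ := h κ γ hκ hγ hγ' D f hf
    have hg' : g ∈ Ideal.span {f} := by
      change g ∈ Module.charIdeal (IwasawaAlgebra p) D.X at hg
      rwa [hf] at hg
    obtain ⟨a, ha⟩ := Ideal.mem_span_singleton'.mp hg'
    refine ⟨PowerSeries.constantCoeff a * c, q, hLq, ?_⟩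
    rw [← ha, map_mul, PadicInt.coe_mul, hf0, PadicInt.coe_mul, mul_assoc]

variable {W : WeierstrassCurve ℚ} [W.IsElliptic] [W.IsGloballyMinimal] {p : ℕ} [hp : Fact p.Prime]

/-! ### §2 The (M)-locus end state over the decl of record `CycLowerLeadingTermAt` -/

/-- **(M) ∧ `r_an = 0`, EVERY odd `p` (`3` included): `MissingLowerBoundAt W p ↔ CycLowerLeadingTermAt W p`**
(granted Delbourgo 1998 Prop. 4 in both transcriptions `hDel`/`hDelX`, GZK, modularity; the Tamagawa
binder is a theorem on (M), `PotMult.not_dvd_tamagawaNumberAt`). On N10's (M) rows the class-level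
missing input is, in the kernel, EXACTLY the decl of record.
[cite: Delbourgo1998, Prop. 4 (p. 144), §2.2 Lemma (ii) (p. 139), Main Conjecture (p. 151)]
[cite: Miller2011LMS, Def. 1.1] -/
theorem _root_.Summit.BirchSwinnertonDyer.Rank1Residual.AdditivePotMult.PotMult.missingLowerBoundAt_iff_cycLowerLeadingTermAt_rankZero
    (hDel : Delbourgo1998.prop4_rankZero_pow_dvd_constantCoeff)
    (hDelX : Delbourgo1998.prop4_rankZero_constantCoeff_eq_unit_mul_of_potMult)
    (hGZK : rank_eq_analyticRank_of_analyticRank_le_one) (hmod : hasEntireLFunction_rat)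
    (hpm : AdditivePotMult.PotMult W p) (hp2 : p ≠ 2) (hr : W.analyticRank = 0) :
    MissingLowerBoundAt W p ↔ CycLowerLeadingTermAt W p :=
  (missingLowerBoundAt_iff_cycLeadingTermDvdAt_of_potMult W p hDel hDelX hGZK hmod hp2 hpm.1 hpm.2 hr
      (hpm.not_dvd_tamagawaNumberAt hp2)).trans
    (cycLeadingTermDvdAt_iff_cycLowerLeadingTermAt W p)

/-- **X4(M) ∧ `r_an = 0`, EVERY odd `p`: the LOWER half `ord_p #Ш_an ≤ ord_p #Ш` from the decl of
record `CycLowerLeadingTermAt W p` ALONE** (+ Delbourgo Prop. 4 / Lemma (ii) `hDelX`, GZK, modularity;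
no image, Tamagawa, Manin or certificate binder). X4(M) stays CONSTRUCTION-SHAPED.
[cite: Delbourgo1998, Prop. 4 (p. 144), §2.2 Lemma (ii) (p. 139), Main Conjecture (p. 151)] -/
theorem _root_.Summit.BirchSwinnertonDyer.Rank1Residual.AdditivePotMult.ClassX4M.missingLowerBoundAt_rankZero_of_cycLowerLeadingTerm
    (hDelX : Delbourgo1998.prop4_rankZero_constantCoeff_eq_unit_mul_of_potMult)
    (hGZK : rank_eq_analyticRank_of_analyticRank_le_one) (hmod : hasEntireLFunction_rat)
    (hX : AdditivePotMult.ClassX4M W p) (hr : W.analyticRank = 0) (hLow : CycLowerLeadingTermAt W p) :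
    MissingLowerBoundAt W p :=
  AdditivePotMult.ClassX4M.missingLowerBoundAt_rankZero_of_cycLeadingTermDvd hDelX hGZK hmod hX hr
    ((cycLeadingTermDvdAt_iff_cycLowerLeadingTermAt W p).mpr hLow)

/-- **X3♯(M) ∧ `r_an = 0`, EVERY odd `p`: the LOWER half from the decl of record ALONE.**
X3♯(M) stays CONSTRUCTION-SHAPED. [cite: Delbourgo1998, Prop. 4 (p. 144), §2.2 Lemma (ii) (p. 139), Main Conjecture (p. 151)] -/
theorem _root_.Summit.BirchSwinnertonDyer.Rank1Residual.AdditivePotMult.ClassX3M.missingLowerBoundAt_rankZero_of_cycLowerLeadingTerm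
    (hDelX : Delbourgo1998.prop4_rankZero_constantCoeff_eq_unit_mul_of_potMult)
    (hGZK : rank_eq_analyticRank_of_analyticRank_le_one) (hmod : hasEntireLFunction_rat)
    (hX : AdditivePotMult.ClassX3M W p) (hr : W.analyticRank = 0) (hLow : CycLowerLeadingTermAt W p) :
    MissingLowerBoundAt W p :=
  AdditivePotMult.ClassX3M.missingLowerBoundAt_rankZero_of_cycLeadingTermDvd hDelX hGZK hmod hX hr
    ((cycLeadingTermDvdAt_iff_cycLowerLeadingTermAt W p).mpr hLow)

/-- **X4(M) ∧ surj(p) ∧ `r_an = 0`, EVERY odd `p` (`3` included: the (M)@3 part of RESIDUAL-MAP §I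
N11): `BSD(E,p)` ⟸ the decl of record `CycLowerLeadingTermAt W p`** + published facts (lower half:
Delbourgo Prop. 4 / Lemma (ii) `hDelX`; upper half: seat additive-p1's
`ClassX4M.missingUpperBoundAt_rankZero_of_surj` — Delbourgo Prop. 4 `hDel`, Kato on the
`ω^{(p−1)/2}`-component `hKato`, Wuthrich Lemma 20 `hL20` at `p = 3`, `hmodD`, GZK, modularity). No
Tamagawa, Manin, `p ∤ c_p`, `j`-witness or certificate binder. X4(M) stays CONSTRUCTION-SHAPED
(the input is printed nowhere); nothing booked.
[cite: Delbourgo1998, Prop. 4 (p. 144), §2.2 Lemma (ii) (p. 139), Main Conjecture (p. 151)]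
[cite: Wuthrich2014, Lemma 20 (p. 399), Cor. 19 (p. 398)] [cite: Kato2004Asterisque, Thm. 17.4 (3) (p. 273)] -/
theorem _root_.Summit.BirchSwinnertonDyer.Rank1Residual.AdditivePotMult.ClassX4M.bsdp_rankZero_of_surj_of_cycLowerLeadingTerm
    (hDel : Delbourgo1998.prop4_rankZero_pow_dvd_constantCoeff)
    (hDelX : Delbourgo1998.prop4_rankZero_constantCoeff_eq_unit_mul_of_potMult)
    (hGZK : rank_eq_analyticRank_of_analyticRank_le_one) (hmod : hasEntireLFunction_rat)
    (hmodD : nonempty_modularParametrizationData)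
    (hL20 : Wuthrich2014.lemma20_surjective_threeAdic_of_semistable)
    (hKato : Wuthrich2014.kato_halfEigenCharIdeal_dvd_cyclotomicPrime_of_surjective)
    (hX : AdditivePotMult.ClassX4M W p) (hr : W.analyticRank = 0) (hsurj : Surj W p)
    (hLow : CycLowerLeadingTermAt W p) : BSDp W p :=
  AdditivePotMult.ClassX4M.bsdp_rankZero_of_surj_of_cycLeadingTermDvd hDel hDelX hGZK hmod hmodD hL20
    hKato hX hr hsurj ((cycLeadingTermDvdAt_iff_cycLowerLeadingTermAt W p).mpr hLow)

/-- **X3♯(M) ∧ `r_an = 0`, EVERY odd `p`: `BSD(E,p)` ⟸ the decl of record `CycLowerLeadingTermAt W p`**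
+ published facts (upper half: seat additive-p1's `ClassX3M.missingUpperBoundAt_rankZero` — Delbourgo
Prop. 4 `hDel`, Wuthrich 2014 Thm. 16 on the `ω^{(p−1)/2}`-component `hW16`, `hmodD`, GZK,
modularity). No image, Tamagawa, Manin or certificate binder. X3♯(M) stays CONSTRUCTION-SHAPED.
[cite: Delbourgo1998, Prop. 4 (p. 144), §2.2 Lemma (ii) (p. 139), Main Conjecture (p. 151)]
[cite: Wuthrich2014, Thm. 16 (p. 397)] -/
theorem _root_.Summit.BirchSwinnertonDyer.Rank1Residual.AdditivePotMult.ClassX3M.bsdp_rankZero_of_cycLowerLeadingTerm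
    (hDel : Delbourgo1998.prop4_rankZero_pow_dvd_constantCoeff)
    (hDelX : Delbourgo1998.prop4_rankZero_constantCoeff_eq_unit_mul_of_potMult)
    (hGZK : rank_eq_analyticRank_of_analyticRank_le_one) (hmod : hasEntireLFunction_rat)
    (hmodD : nonempty_modularParametrizationData)
    (hW16 : Wuthrich2014.thm16_halfEigenCharIdeal_dvd_cyclotomicPrime)
    (hX : AdditivePotMult.ClassX3M W p) (hr : W.analyticRank = 0) (hLow : CycLowerLeadingTermAt W p) :
    BSDp W p :=
  AdditivePotMult.ClassX3M.bsdp_rankZero_of_cycLeadingTermDvd hDel hDelX hGZK hmod hmodD hW16 hX hr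
    ((cycLeadingTermDvdAt_iff_cycLowerLeadingTermAt W p).mpr hLow)

/-- **X4(M) ∧ `r_an = 0`, EVERY odd `p`: `BSD(E,p)` ⟸ Delbourgo's Main Conjecture (M) as an EQUALITY
at `T = 0` (`CycCharLeadingTermAt W p`, seat additive-p2's typed input: every generator has
`f(0) = unit · L(E,1)/Ω_E`)** + Delbourgo 1998 Prop. 4 in both transcriptions + GZK + modularity —
NO image, Tamagawa, Manin, Wuthrich/Kato-reading or certificate binder (upper half from the
divisibility direction `cycLeadingTermAt_of_cycChar`, lower half from `cycLowerLeadingTermAt_of_cycChar`;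
`p ∤ c_p` is a theorem on (M)). X4(M) stays CONSTRUCTION-SHAPED; nothing booked.
[cite: Delbourgo1998, Prop. 4 (p. 144), §2.2 Lemma (ii) (p. 139), Main Conjecture (p. 151)] -/
theorem _root_.Summit.BirchSwinnertonDyer.Rank1Residual.AdditivePotMult.ClassX4M.bsdp_rankZero_of_cycChar
    (hDel : Delbourgo1998.prop4_rankZero_pow_dvd_constantCoeff)
    (hDelX : Delbourgo1998.prop4_rankZero_constantCoeff_eq_unit_mul_of_potMult)
    (hGZK : rank_eq_analyticRank_of_analyticRank_le_one) (hmod : hasEntireLFunction_rat)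
    (hX : AdditivePotMult.ClassX4M W p) (hr : W.analyticRank = 0) (hMC : CycCharLeadingTermAt W p) :
    BSDp W p :=
  AdditivePotMult.ClassX4M.bsdp_rankZero_of_cycLeadingTerm_of_cycLeadingTermDvd hDel hDelX hGZK hmod hX
    hr (AdditivePotMult.ClassX4M.not_dvd_tamagawaNumberAt hX) (cycLeadingTermAt_of_cycChar hMC)
    ((cycLeadingTermDvdAt_iff_cycLowerLeadingTermAt W p).mpr (cycLowerLeadingTermAt_of_cycChar hMC))

/-- **X3♯(M) ∧ `r_an = 0`, EVERY odd `p`: `BSD(E,p)` ⟸ Delbourgo's Main Conjecture (M) as an EQUALITY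
at `T = 0` (`CycCharLeadingTermAt W p`)** + Prop. 4 both ways + GZK + modularity; no image hypothesis
anywhere. X3♯(M) stays CONSTRUCTION-SHAPED. [cite: Delbourgo1998, Prop. 4 (p. 144), §2.2 Lemma (ii) (p. 139), Main Conjecture (p. 151)] -/
theorem _root_.Summit.BirchSwinnertonDyer.Rank1Residual.AdditivePotMult.ClassX3M.bsdp_rankZero_of_cycChar
    (hDel : Delbourgo1998.prop4_rankZero_pow_dvd_constantCoeff)
    (hDelX : Delbourgo1998.prop4_rankZero_constantCoeff_eq_unit_mul_of_potMult)
    (hGZK : rank_eq_analyticRank_of_analyticRank_le_one) (hmod : hasEntireLFunction_rat)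
    (hX : AdditivePotMult.ClassX3M W p) (hr : W.analyticRank = 0) (hMC : CycCharLeadingTermAt W p) :
    BSDp W p :=
  AdditivePotMult.ClassX3M.bsdp_rankZero_of_cycLeadingTerm_of_cycLeadingTermDvd hDel hDelX hGZK hmod hX
    hr (AdditivePotMult.ClassX3M.not_dvd_tamagawaNumberAt hX) (cycLeadingTermAt_of_cycChar hMC)
    ((cycLeadingTermDvdAt_iff_cycLowerLeadingTermAt W p).mpr (cycLowerLeadingTermAt_of_cycChar hMC))

/-- **X4(M) ∧ surj(p) ∧ `r_an = 0`, EVERY odd `p`: what remains of X4♯ is EXACTLY the decl of record**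
— `Typed.X4.MissingInputAt W p ↔ CycLowerLeadingTermAt W p` (granted the published-fact upper half
of seat additive-p1 and Prop. 4 both ways; Tamagawa binder a theorem on (M)).
[cite: Delbourgo1998, Prop. 4 (p. 144), §2.2 Lemma (ii) (p. 139), Main Conjecture (p. 151)]
[cite: Wuthrich2014, Lemma 20 (p. 399), Cor. 19 (p. 398)] -/
theorem _root_.Summit.BirchSwinnertonDyer.Rank1Residual.AdditivePotMult.ClassX4M.x4MissingInputAt_iff_cycLowerLeadingTermAt_rankZero_of_surj
    (hDel : Delbourgo1998.prop4_rankZero_pow_dvd_constantCoeff)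
    (hDelX : Delbourgo1998.prop4_rankZero_constantCoeff_eq_unit_mul_of_potMult)
    (hGZK : rank_eq_analyticRank_of_analyticRank_le_one) (hmod : hasEntireLFunction_rat)
    (hmodD : nonempty_modularParametrizationData)
    (hL20 : Wuthrich2014.lemma20_surjective_threeAdic_of_semistable)
    (hKato : Wuthrich2014.kato_halfEigenCharIdeal_dvd_cyclotomicPrime_of_surjective)
    (hX : AdditivePotMult.ClassX4M W p) (hr : W.analyticRank = 0) (hsurj : Surj W p) :
    X4.MissingInputAt W p ↔ CycLowerLeadingTermAt W p :=
  (AdditivePotMult.ClassX4M.missingInputAt_iff_cycLeadingTermDvdAt_rankZero_of_surj hDel hDelX hGZK hmod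
      hmodD hL20 hKato hX hr hsurj (AdditivePotMult.ClassX4M.not_dvd_tamagawaNumberAt hX)).trans
    (cycLeadingTermDvdAt_iff_cycLowerLeadingTermAt W p)

/-- **X3♯(M) ∧ `r_an = 0`, EVERY odd `p`: what remains of X3♯ is EXACTLY the decl of record** —
`Typed.X3.MissingInputAt W p ↔ CycLowerLeadingTermAt W p`.
[cite: Delbourgo1998, Prop. 4 (p. 144), §2.2 Lemma (ii) (p. 139), Main Conjecture (p. 151)]
[cite: Wuthrich2014, Thm. 16 (p. 397)] -/
theorem _root_.Summit.BirchSwinnertonDyer.Rank1Residual.AdditivePotMult.ClassX3M.x3MissingInputAt_iff_cycLowerLeadingTermAt_rankZero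
    (hDel : Delbourgo1998.prop4_rankZero_pow_dvd_constantCoeff)
    (hDelX : Delbourgo1998.prop4_rankZero_constantCoeff_eq_unit_mul_of_potMult)
    (hGZK : rank_eq_analyticRank_of_analyticRank_le_one) (hmod : hasEntireLFunction_rat)
    (hmodD : nonempty_modularParametrizationData)
    (hW16 : Wuthrich2014.thm16_halfEigenCharIdeal_dvd_cyclotomicPrime)
    (hX : AdditivePotMult.ClassX3M W p) (hr : W.analyticRank = 0) :
    X3.MissingInputAt W p ↔ CycLowerLeadingTermAt W p :=
  (AdditivePotMult.ClassX3M.missingInputAt_iff_cycLeadingTermDvdAt_rankZero hDel hDelX hGZK hmod hmodD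
      hW16 hX hr (AdditivePotMult.ClassX3M.not_dvd_tamagawaNumberAt hX)).trans
    (cycLeadingTermDvdAt_iff_cycLowerLeadingTermAt W p)

/-! ### §3 The (G)-ordinary sockets over the decl of record (appended 2026-08-21; for T-b2c / the (G-ord)@3 Delbourgo-2002 bridge) -/

/-- **X4♯(G-ord) (any defect) ∧ `r_an = 0`: the LOWER half from the decl of record
`CycLowerLeadingTermAt W p` AND the exactness input `ExactLeadingTermAt W p`** (GZK, modularity).
Socket: a seat that proves `ExactLeadingTermAt W p` on a (G-ord) sub-locus (e.g. from Delbourgo,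
J. Number Theory 95 (2002) Main Thm (B) at `p = 3` on the `I₀*`-ordinary rows, off the anomalous
ones) gets the lower half there from the ONE typed `T = 0` input. X4♯(G-ord) stays
CONSTRUCTION-SHAPED. [cite: Delbourgo1998, Prop. 4 (p. 144), Main Conjecture (p. 151) (shapes)] -/
theorem ClassX4Gord.missingLowerBoundAt_rankZero_of_cycLowerLeadingTerm_of_exact
    {W : WeierstrassCurve ℚ} [W.IsElliptic] [W.IsGloballyMinimal] {p : ℕ} [Fact p.Prime]
    (hGZK : rank_eq_analyticRank_of_analyticRank_le_one) (hmod : hasEntireLFunction_rat)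
    (hX : ClassX4Gord W p) (hr : W.analyticRank = 0) (hLow : CycLowerLeadingTermAt W p)
    (hEx : ExactLeadingTermAt W p) : MissingLowerBoundAt W p :=
  ClassX4Gord.missingLowerBoundAt_rankZero_of_cycLeadingTermDvd_of_exact hGZK hmod hX hr
    ((cycLeadingTermDvdAt_iff_cycLowerLeadingTermAt W p).mpr hLow) hEx

/-- **X3♯(G-ord) (any defect) ∧ `r_an = 0`: the LOWER half from the decl of record AND
`ExactLeadingTermAt W p`.** X3♯(G-ord) stays CONSTRUCTION-SHAPED.
[cite: Delbourgo1998, Prop. 4 (p. 144), Main Conjecture (p. 151) (shapes)] -/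
theorem ClassX3Gord.missingLowerBoundAt_rankZero_of_cycLowerLeadingTerm_of_exact
    {W : WeierstrassCurve ℚ} [W.IsElliptic] [W.IsGloballyMinimal] {p : ℕ} [Fact p.Prime]
    (hGZK : rank_eq_analyticRank_of_analyticRank_le_one) (hmod : hasEntireLFunction_rat)
    (hX : ClassX3Gord W p) (hr : W.analyticRank = 0) (hLow : CycLowerLeadingTermAt W p)
    (hEx : ExactLeadingTermAt W p) : MissingLowerBoundAt W p :=
  ClassX3Gord.missingLowerBoundAt_rankZero_of_cycLeadingTermDvd_of_exact hGZK hmod hX hr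
    ((cycLeadingTermDvdAt_iff_cycLowerLeadingTermAt W p).mpr hLow) hEx

/-- **Any curve, `r_an = 0`, any `p`: the LOWER half from the decl of record `CycLowerLeadingTermAt W p`
AND `ExactLeadingTermAt W p`** — the class-agnostic socket (no additivity used in the bookkeeping).
[cite: Delbourgo1998, Prop. 4 (p. 144), Main Conjecture (p. 151) (shapes)] [cite: Miller2011LMS, Def. 1.1] -/
theorem missingLowerBoundAt_of_cycLowerLeadingTerm_of_exact
    (W : WeierstrassCurve ℚ) [W.IsElliptic] [W.IsGloballyMinimal] (p : ℕ) [Fact p.Prime]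
    (hGZK : rank_eq_analyticRank_of_analyticRank_le_one) (hmod : hasEntireLFunction_rat)
    (hr : W.analyticRank = 0) (hLow : CycLowerLeadingTermAt W p) (hEx : ExactLeadingTermAt W p) :
    MissingLowerBoundAt W p :=
  missingLowerBoundAt_of_cycLeadingTermDvd_of_exact W p hGZK hmod hr
    ((cycLeadingTermDvdAt_iff_cycLowerLeadingTermAt W p).mpr hLow) hEx

end Summit.BirchSwinnertonDyer.Rank1Residual.Additive

end
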